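import Literature.Probability.Percolation.SetPassengerExchange
import HarnessLib

/-!
# `NoHeavyLowerTail` (stmt-CriticalPhenomena-4575) — the ATTACHED-LIGHTNESS comparison (♦): "given that `z` is attached to the set
# `X`, the most light-prone member of `X` is at least as likely to be light as `z`"

Support file (prover `prim-hp-8`, PL programme; `--supports stmt-CriticalPhenomena-4575`).  No definitions, no named facts, no sorries.

Setting: `μ = prodBernoulli w` on a finite vertex type, relays `A`, level `j`, `R_v = {|π(v)| ≤ j}` (`π(v) = A ∩ C(v)`), a finite vertex set
`U`, and two vertices `z ≠ x` with `μ(R_z) ≤ μ(R_x)` (`x` is at least as light-prone as `z`).  Write `{z ↔ U} = ⋃_{y∈U} {z ↔ y}`.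

* `attached_lonely_le_of_le` — `μ(z ↮ x, z ↔ U, R_z) ≤ μ(z ↮ x, z ↔ U, R_x)`.  Proof: on `D = {z ↮ x}`, `{z ↔ U}` is of type `(+)` for the
  pair `(z, x)`, `R_z` of type `(−)`, `R_x` of type `(+)`, so BHK's two-cluster exchange (`lonelyTransfer_of_typePlus`) transfers
  `μ(D ∩ R_z) ≤ μ(D ∩ R_x)` (`real_inter_lonely_le_of_le`) to the rider `{z ↔ U}`.
* `attached_lonely_le_of_le'` — the same with `X = U ∪ {x}` in place of `U` on the whole space: `μ(z ↔ X, R_z) ≤ μ(z ↔ X, R_x)`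
  (on `{z ↔ x}` the two loneliness events coincide).

This is inequality (♦) of the memo PROOF-COIN-REDUCTION.md §14 (the "worse outsider" case), the BHK half of the SET-GLUING TOP: gluing a
relay set `X` together costs its most light-prone member at least as much lightness as it costs any less light-prone relay; with the unglue
identity of §14 it yields one half of Conjecture S on the star stratum (pairs of glued relay sets).  Census: 0 / 19 837 exact cases
(kit j067900, sgt2).  [cite: VandenbergHaggstromKahn2005, Thm. 1.5 (p. 7) — via `twoClusterExchange`]
-/

noncomputable section

namespace Summit.CriticalPhenomena.PercolationContinuityZ3.Theorems

namespace SetGluing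

open MeasureTheory Set Literature.Probability.LatticeModels Literature.Probability.Percolation
open scoped Classical BigOperators

variable {V : Type*} [Fintype V]

omit [Fintype V] in
/-- `{z ↔ U} = ⋃_{y∈U} {z ↔ y}` is of type `(+)` for the pair `(z, x)` (closed under enlarging `C_z`, shrinking `C_x`). [folklore] -/
theorem typePlus_conn_set (z x : V) (U : Finset V) ⦃ω ω' : BondConfig V⦄
    (h1 : openEdgeCluster ω z ⊆ openEdgeCluster ω' z) (h2 : openEdgeCluster ω' x ⊆ openEdgeCluster ω x)
    (hω : ω ∈ ⋃ y ∈ U, (openConn z y : Set (BondConfig V))) :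
    ω' ∈ ⋃ y ∈ U, (openConn z y : Set (BondConfig V)) := by
  rw [mem_iUnion₂] at hω ⊢
  obtain ⟨y, hy, hzy⟩ := hω
  exact ⟨y, hy, typePlus_openConn z x y h1 h2 hzy⟩

/-- **Attached lightness (♦), disjoint form.**  For `z ≠ x` with `μ(R_z) ≤ μ(R_x)` and any finite vertex set `U`:
`μ({z ↮ x} ∩ {z ↔ U} ∩ R_z) ≤ μ({z ↮ x} ∩ {z ↔ U} ∩ R_x)` — given that `z` is attached to `U` and not to `x`, the more light-prone
vertex `x` is at least as likely to be lonely as `z`. [cite: VandenbergHaggstromKahn2005, Thm. 1.5 (p. 7) — corollary] -/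
theorem attached_lonely_le_of_le (w : Sym2 V → unitInterval) (A : Finset V) (j : ℕ) {z x : V} (hzx : z ≠ x)
    (U : Finset V)
    (hle : (prodBernoulli w).real {ω : BondConfig V | (A.filter fun y => ω ∈ openConn z y).card ≤ j} ≤
      (prodBernoulli w).real {ω : BondConfig V | (A.filter fun y => ω ∈ openConn x y).card ≤ j}) :
    (prodBernoulli w).real ((openConn z x)ᶜ ∩ (⋃ y ∈ U, (openConn z y : Set (BondConfig V))) ∩
        {ω : BondConfig V | (A.filter fun y => ω ∈ openConn z y).card ≤ j}) ≤
      (prodBernoulli w).real ((openConn z x)ᶜ ∩ (⋃ y ∈ U, (openConn z y : Set (BondConfig V))) ∩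
        {ω : BondConfig V | (A.filter fun y => ω ∈ openConn x y).card ≤ j}) := by
  set μ := prodBernoulli w with hμ
  set D : Set (BondConfig V) := (openConn z x)ᶜ with hD
  set P : Set (BondConfig V) := ⋃ y ∈ U, (openConn z y : Set (BondConfig V)) with hP
  set Rz : Set (BondConfig V) := {ω | (A.filter fun y => ω ∈ openConn z y).card ≤ j} with hRz
  set Rx : Set (BondConfig V) := {ω | (A.filter fun y => ω ∈ openConn x y).card ≤ j} with hRx
  have hmeas : ∀ S : Set (BondConfig V), MeasurableSet S := fun S => (Set.toFinite S).measurableSet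
  -- the exchange: μ(D ∩ (Rz ∩ Rxᶜ ∩ P)) ≤ μ(D ∩ (Rx ∩ Rzᶜ ∩ P))
  have hex : μ.real (D ∩ (Rz ∩ Rxᶜ ∩ P)) ≤ μ.real (D ∩ (Rx ∩ Rzᶜ ∩ P)) :=
    lonelyTransfer_of_typePlus w A j hzx (fun _ _ h1 h2 hω => typePlus_conn_set z x U h1 h2 hω)
      (real_inter_lonely_le_of_le w A j z x hle)
  -- add the common part μ(D ∩ P ∩ Rz ∩ Rx)
  have hs1 : D ∩ P ∩ Rz = (D ∩ (Rz ∩ Rxᶜ ∩ P)) ∪ (D ∩ P ∩ Rz ∩ Rx) := by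
    ext ω; simp only [mem_inter_iff, mem_union, mem_compl_iff]; tauto
  have hd1 : Disjoint (D ∩ (Rz ∩ Rxᶜ ∩ P)) (D ∩ P ∩ Rz ∩ Rx) := by
    rw [Set.disjoint_left]; rintro ω ⟨_, ⟨_, h2⟩, _⟩ ⟨_, h4⟩; exact h2 h4
  have hs2 : D ∩ P ∩ Rx = (D ∩ (Rx ∩ Rzᶜ ∩ P)) ∪ (D ∩ P ∩ Rz ∩ Rx) := by
    ext ω; simp only [mem_inter_iff, mem_union, mem_compl_iff]; tauto
  have hd2 : Disjoint (D ∩ (Rx ∩ Rzᶜ ∩ P)) (D ∩ P ∩ Rz ∩ Rx) := by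
    rw [Set.disjoint_left]; rintro ω ⟨_, ⟨_, h2⟩, _⟩ ⟨⟨_, h3⟩, _⟩; exact h2 h3
  have e1 : μ.real (D ∩ P ∩ Rz) = μ.real (D ∩ (Rz ∩ Rxᶜ ∩ P)) + μ.real (D ∩ P ∩ Rz ∩ Rx) := by
    have h := congrArg μ.real hs1
    rw [measureReal_union hd1 (hmeas _)] at h
    exact h
  have e2 : μ.real (D ∩ P ∩ Rx) = μ.real (D ∩ (Rx ∩ Rzᶜ ∩ P)) + μ.real (D ∩ P ∩ Rz ∩ Rx) := by
    have h := congrArg μ.real hs2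
    rw [measureReal_union hd2 (hmeas _)] at h
    exact h
  change μ.real (D ∩ P ∩ Rz) ≤ μ.real (D ∩ P ∩ Rx)
  rw [e1, e2]
  linarith

/-- **Attached lightness (♦).**  For `z ≠ x` with `μ(R_z) ≤ μ(R_x)` and any finite vertex set `U`:
`μ({z ↔ U ∪ {x}} ∩ R_z) ≤ μ({z ↔ U ∪ {x}} ∩ R_x)`, where `{z ↔ U ∪ {x}} = {z ↔ x} ∪ {z ↔ U}`: given that `z` is attached to the set
`X = U ∪ {x}`, the member `x` (at least as light-prone as `z` a priori) is at least as likely to be lonely as `z`.  On `{z ↔ x}` the two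
loneliness events coincide; off it this is `attached_lonely_le_of_le`. [cite: VandenbergHaggstromKahn2005, Thm. 1.5 (p. 7) — corollary] -/
theorem attached_lonely_le_of_le' (w : Sym2 V → unitInterval) (A : Finset V) (j : ℕ) {z x : V} (hzx : z ≠ x)
    (U : Finset V)
    (hle : (prodBernoulli w).real {ω : BondConfig V | (A.filter fun y => ω ∈ openConn z y).card ≤ j} ≤
      (prodBernoulli w).real {ω : BondConfig V | (A.filter fun y => ω ∈ openConn x y).card ≤ j}) :
    (prodBernoulli w).real (((openConn z x : Set (BondConfig V)) ∪ ⋃ y ∈ U, (openConn z y : Set (BondConfig V))) ∩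
        {ω : BondConfig V | (A.filter fun y => ω ∈ openConn z y).card ≤ j}) ≤
      (prodBernoulli w).real (((openConn z x : Set (BondConfig V)) ∪ ⋃ y ∈ U, (openConn z y : Set (BondConfig V))) ∩
        {ω : BondConfig V | (A.filter fun y => ω ∈ openConn x y).card ≤ j}) := by
  set μ := prodBernoulli w with hμ
  set E : Set (BondConfig V) := (openConn z x : Set (BondConfig V)) with hE
  set P : Set (BondConfig V) := ⋃ y ∈ U, (openConn z y : Set (BondConfig V)) with hP
  set Rz : Set (BondConfig V) := {ω | (A.filter fun y => ω ∈ openConn z y).card ≤ j} with hRz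
  set Rx : Set (BondConfig V) := {ω | (A.filter fun y => ω ∈ openConn x y).card ≤ j} with hRx
  have hmeas : ∀ S : Set (BondConfig V), MeasurableSet S := fun S => (Set.toFinite S).measurableSet
  -- on {z ↔ x} the relay filters of z and x coincide
  have hco : ∀ ω ∈ E, (ω ∈ Rz ↔ ω ∈ Rx) := by
    intro ω hω
    have hzx' : (openGraph ω).Reachable z x := hω
    have hfilt : (A.filter fun y => ω ∈ openConn z y) = (A.filter fun y => ω ∈ openConn x y) := by
      apply Finset.filter_congr
      intro y _
      change (openGraph ω).Reachable z y ↔ (openGraph ω).Reachable x y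
      exact ⟨fun h => hzx'.symm.trans h, fun h => hzx'.trans h⟩
    simp only [hRz, hRx, mem_setOf_eq, hfilt]
  -- split (E ∪ P) ∩ R = (E ∩ R) ⊔ (Eᶜ ∩ P ∩ R)
  have hsplit : ∀ R : Set (BondConfig V), μ.real ((E ∪ P) ∩ R) = μ.real (E ∩ R) + μ.real (Eᶜ ∩ P ∩ R) := by
    intro R
    have hs : (E ∪ P) ∩ R = (E ∩ R) ∪ (Eᶜ ∩ P ∩ R) := by
      ext ω; simp only [mem_inter_iff, mem_union, mem_compl_iff]; tauto
    have hd : Disjoint (E ∩ R) (Eᶜ ∩ P ∩ R) := by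
      rw [Set.disjoint_left]; rintro ω ⟨he, _⟩ ⟨⟨hne, _⟩, _⟩; exact hne he
    have h := congrArg μ.real hs
    rw [measureReal_union hd (hmeas _)] at h
    exact h
  have hEeq : μ.real (E ∩ Rz) = μ.real (E ∩ Rx) := by
    have : E ∩ Rz = E ∩ Rx := by
      ext ω; constructor
      · rintro ⟨he, hr⟩; exact ⟨he, (hco ω he).1 hr⟩
      · rintro ⟨he, hr⟩; exact ⟨he, (hco ω he).2 hr⟩
    rw [this]
  have hdis := attached_lonely_le_of_le w A j hzx U hle
  change μ.real ((E ∪ P) ∩ Rz) ≤ μ.real ((E ∪ P) ∩ Rx)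
  rw [hsplit Rz, hsplit Rx, hEeq]
  have h1 : μ.real (Eᶜ ∩ P ∩ Rz) ≤ μ.real (Eᶜ ∩ P ∩ Rx) := hdis
  linarith

end SetGluing

end Summit.CriticalPhenomena.PercolationContinuityZ3.Theorems

end
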